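import Mathlib.Algebra.BigOperators.Group.Multiset.Basic
import Mathlib.Data.Real.Basic
import Mathlib.Tactic.Linarith
import Mathlib.Tactic.NormNum
import Mathlib.Tactic.FieldSimp
import HarnessLib

/-!
# QUANT lane R8: NO POTENTIAL OF THE MARGINAL MULTISET PROVES THE TREE ROW BY THE ROOT-GATE RECURSION (a kernel no-go)

builds on p205010 (kernel theorem, internal audit signed; external expert review pending)

Support file (`--supports stmt-CriticalPhenomena-4575`), QUANT lane, LEAD seat prim-quant-lead (gen 36), rung R8 of
`run/shared/lean/prim/quant/LADDER.md`; memo `run/shared/lean/prim/quant/prim-quant-lead-g36/LEAD-NOTES-G36.md` N1 (README V351).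
Theorems only, Mathlib only, standard axioms, no sorries.

THE QUESTION.  `Quant.FarTreeRow` (`…QuantFarTreeRow`, OPEN) says: on a rooted forest of independent gates, if the relay marginals
`T_a` (products of the gate weights on the ancestral line) have `Σ_a T_a > 2j` then `P(N ≤ j) ≤ 1 − min_a T_a` (`N` = number of reached relays).
The count law obeys the ROOT-GATE RECURSION: for a root gate of weight `q` whose tree carries the (contracted) marginal multiset `U` and with
`V` the marginals of the other trees, `P(N ≤ j) = (1−q)·P(N_V ≤ j) + q·P(N_{U ⊎ V} ≤ j)`, a sure relay shifts the layer, the empty forest has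
`N = 0`.  The cheapest conceivable proof of the row would exhibit a POTENTIAL `Φ(j; W)` of the layer and the marginal MULTISET alone that
dominates these three steps and satisfies the row.  This file shows that no such `Φ` exists:

* `QuantCensus.no_marginal_potential` — there is no `Φ : ℕ → Multiset ℝ → ℝ` with (P0) `Φ ≥ 0` on multisets of numbers in `(0,1]`,
  (P1) `Φ j ∅ ≥ 1`, (P2) `Φ (j+1) (1 ::ₘ W) ≥ Φ j W` (sure relay), (P3) `Φ j (q·U ⊎ V) ≥ (1−q)·Φ j V + q·Φ j (U ⊎ V)` for `0 < q < 1`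
  (root gate), and (ROW) `Σ W > 2j ⟹ Φ j W ≤ 1 − x` for every `x ∈ W`.
  WITNESS (lead g36, exact engine `prim-quant-lead-g36/explore/phi_adaptive.py`): `W = {5/6, 5/6, 5/6}`, `j = 1`.  Chaining (P0)–(P3) along
  the ADAPTIVE strategy "reveal one relay; if its gate is closed run the other two INDEPENDENT (value `1 − a²`), if open GLUE them (value `1 − a`)"
  gives `Φ 1 W ≥ (1−a)(1−a²) + a(1−a) = 41/216` at `a = 5/6`, while (ROW) (`Σ W = 5/2 > 2`) gives `Φ 1 W ≤ 1/6 = 36/216`.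
  READING: the recursion is blind to the fact that the sub-forest `V` must be THE SAME forest on both branches; any inductive invariant for the
  row must therefore carry the JOINT law of sub-forests (as the lane's DEC certificates do) — marginal data, or per-layer suprema of sub-forest
  laws (the same number `41/216` is the CDF at `1` of `Z ∗ Bern(5/6)` with `Z = {1/6, 5/36, 25/36}` the per-layer sup profile of the
  two-relay laws), cannot close the induction.  Independently re-derived by ARM-REF g100 (`ARM-REF-G100.md` §6).

[this work]; the row served [cite: KozmaNitzan2024, Conjecture 3 (p. 15)]; product measure [cite: Grimmett1999, §1.3 p. 10].
-/

namespace Summit.CriticalPhenomena.PercolationContinuityZ3.Theorems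

namespace QuantCensus

/-- **No potential of (layer, marginal multiset) is compatible with the root-gate recursion AND the tree row.**
(P0) nonnegativity on multisets of numbers in `(0,1]`, (P1) empty forest, (P2) sure relay, (P3) root gate of weight `q ∈ (0,1)` above a
sub-forest with contracted marginals `U`, next to independent trees with marginals `V`, (ROW) the conclusion of `Quant.FarTreeRow` with
floor any member of the multiset.  Witness `{5/6, 5/6, 5/6}` at layer `1`: the axioms force `Φ ≥ 41/216 > 1/6`.
builds on p205010 (kernel theorem, internal audit signed; external expert review pending). [this work] -/
theorem no_marginal_potential :
    ¬ ∃ Φ : ℕ → Multiset ℝ → ℝ,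
      (∀ (j : ℕ) (W : Multiset ℝ), (∀ x ∈ W, 0 < x ∧ x ≤ 1) → 0 ≤ Φ j W) ∧
      (∀ j : ℕ, 1 ≤ Φ j 0) ∧
      (∀ (j : ℕ) (W : Multiset ℝ), Φ j W ≤ Φ (j + 1) (1 ::ₘ W)) ∧
      (∀ (j : ℕ) (q : ℝ) (U V : Multiset ℝ), 0 < q → q < 1 → (∀ x ∈ U, 0 < x ∧ x ≤ 1) → (∀ x ∈ V, 0 < x ∧ x ≤ 1) →
        (1 - q) * Φ j V + q * Φ j (U + V) ≤ Φ j (U.map (fun x => q * x) + V)) ∧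
      (∀ (j : ℕ) (W : Multiset ℝ), (∀ x ∈ W, 0 < x ∧ x ≤ 1) → (2 * j : ℝ) < W.sum → ∀ x ∈ W, Φ j W ≤ 1 - x) := by
  rintro ⟨Φ, hP0, hP1, hP2, hP3, hROW⟩
  -- the witness weight
  set a : ℝ := 5 / 6 with ha
  have ha0 : 0 < a := by rw [ha]; norm_num
  have ha1 : a < 1 := by rw [ha]; norm_num
  have hale : a ≤ 1 := ha1.le
  -- validity of the multisets used
  have hv1 : ∀ x ∈ ({1} : Multiset ℝ), 0 < x ∧ x ≤ 1 := by
    intro x hx; rw [Multiset.mem_singleton] at hx; subst hx; norm_num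
  have hv11 : ∀ x ∈ ({1, 1} : Multiset ℝ), 0 < x ∧ x ≤ 1 := by
    intro x hx
    simp only [Multiset.insert_eq_cons, Multiset.mem_cons, Multiset.mem_singleton, or_self] at hx
    subst hx; norm_num
  have hv0 : ∀ x ∈ (0 : Multiset ℝ), 0 < x ∧ x ≤ 1 := by intro x hx; simp at hx
  have hva : ∀ x ∈ ({a} : Multiset ℝ), 0 < x ∧ x ≤ 1 := by
    intro x hx; rw [Multiset.mem_singleton] at hx; subst hx; exact ⟨ha0, hale⟩
  have hvaa : ∀ x ∈ ({a, a} : Multiset ℝ), 0 < x ∧ x ≤ 1 := by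
    intro x hx
    simp only [Multiset.insert_eq_cons, Multiset.mem_cons, Multiset.mem_singleton, or_self] at hx
    subst hx; exact ⟨ha0, hale⟩
  have hvaaa : ∀ x ∈ ({a, a, a} : Multiset ℝ), 0 < x ∧ x ≤ 1 := by
    intro x hx
    simp only [Multiset.insert_eq_cons, Multiset.mem_cons, Multiset.mem_singleton, or_self] at hx
    subst hx; exact ⟨ha0, hale⟩
  -- multiset identities for the gate steps (U = {1} or {1,1}, gate a)
  have m1 : ({1} : Multiset ℝ).map (fun x => a * x) + 0 = {a} := by simp
  have m2 : ({1} : Multiset ℝ).map (fun x => a * x) + {a} = {a, a} := by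
    simp [Multiset.insert_eq_cons, Multiset.singleton_add]
  have m3 : ({1, 1} : Multiset ℝ).map (fun x => a * x) + 0 = {a, a} := by
    simp [Multiset.insert_eq_cons]
  have m4 : ({1} : Multiset ℝ).map (fun x => a * x) + {a, a} = {a, a, a} := by
    simp [Multiset.insert_eq_cons, Multiset.singleton_add]
  have u1 : ({1} : Multiset ℝ) + 0 = {1} := by simp
  have u2 : ({1} : Multiset ℝ) + {a} = 1 ::ₘ {a} := Multiset.singleton_add 1 {a}
  have u3 : ({1, 1} : Multiset ℝ) + 0 = {1, 1} := by simp
  have u4 : ({1} : Multiset ℝ) + {a, a} = 1 ::ₘ {a, a} := Multiset.singleton_add 1 {a, a}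
  -- (1) base values
  have e0 : 1 ≤ Φ 0 0 := hP1 0
  have e1 : 1 ≤ Φ 1 0 := hP1 1
  have z1 : 0 ≤ Φ 0 {1} := hP0 0 {1} hv1
  have z11 : 0 ≤ Φ 0 {1, 1} := hP0 0 {1, 1} hv11
  -- (3) Φ 1 {1} ≥ Φ 0 ∅ ≥ 1
  have s1 : Φ 0 0 ≤ Φ 1 (1 ::ₘ 0) := hP2 0 0
  have c1 : (1 ::ₘ (0 : Multiset ℝ)) = {1} := rfl
  rw [c1] at s1
  -- (4) Φ 1 {a} ≥ (1-a) Φ 1 ∅ + a Φ 1 {1}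
  have g1 := hP3 1 a {1} 0 ha0 ha1 hv1 hv0
  rw [m1, u1] at g1
  -- (5) Φ 0 {a} ≥ (1-a) Φ 0 ∅ + a Φ 0 {1}
  have g2 := hP3 0 a {1} 0 ha0 ha1 hv1 hv0
  rw [m1, u1] at g2
  -- (6) Φ 1 (1 ::ₘ {a}) ≥ Φ 0 {a}
  have s2 : Φ 0 {a} ≤ Φ 1 (1 ::ₘ {a}) := hP2 0 {a}
  -- (7) Φ 1 {a,a} ≥ (1-a) Φ 1 {a} + a Φ 1 (1 ::ₘ {a})
  have g3 := hP3 1 a {1} {a} ha0 ha1 hv1 hva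
  rw [m2, u2] at g3
  -- (8) Φ 0 {a,a} ≥ (1-a) Φ 0 ∅ + a Φ 0 {1,1}   (the GLUED pair)
  have g4 := hP3 0 a {1, 1} 0 ha0 ha1 hv11 hv0
  rw [m3, u3] at g4
  -- (9) Φ 1 (1 ::ₘ {a,a}) ≥ Φ 0 {a,a}
  have s3 : Φ 0 {a, a} ≤ Φ 1 (1 ::ₘ {a, a}) := hP2 0 {a, a}
  -- (10) Φ 1 {a,a,a} ≥ (1-a) Φ 1 {a,a} + a Φ 1 (1 ::ₘ {a,a})
  have g5 := hP3 1 a {1} {a, a} ha0 ha1 hv1 hvaa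
  rw [m4, u4] at g5
  -- (ROW) Σ {a,a,a} = 5/2 > 2
  have hsum : (2 * (1 : ℕ) : ℝ) < ({a, a, a} : Multiset ℝ).sum := by
    simp [Multiset.insert_eq_cons]
    rw [ha]; norm_num
  have hmem : a ∈ ({a, a, a} : Multiset ℝ) := by simp
  have r := hROW 1 {a, a, a} hvaaa hsum a hmem
  -- chain: lower bounds
  have l4 : 1 ≤ Φ 1 {a} := by nlinarith
  have l5 : 1 - a ≤ Φ 0 {a} := by nlinarith
  have l7 : (1 - a) + a * (1 - a) ≤ Φ 1 {a, a} := by nlinarith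
  have l8 : 1 - a ≤ Φ 0 {a, a} := by nlinarith
  have l10 : (1 - a) * ((1 - a) + a * (1 - a)) + a * (1 - a) ≤ Φ 1 {a, a, a} := by nlinarith
  -- numerics: at a = 5/6 the lower bound is 41/216 > 1/6 = 1 - a
  rw [ha] at l10 r
  norm_num at l10 r
  linarith
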